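import Summits.QuantumFields.YangMills.Theorems.IR.BlockedActivityWLocChain
import Summits.QuantumFields.YangMills.Theorems.BalabanLadderIRClauseILocality
import Literature.MathematicalPhysics.QuantumLattice.StrongExpDecayBoundaryInfluenceNonlocal
import HarnessLib

/-!
# Crux `IR` (stmt-QuantumFields-19354), lane B «strong coupling AFTER BLOCKING»: chain representations, part 5 — the tube is READABLE at its tip

Helper module for item `stmt-QuantumFields-19354` (`--supports`; it closes nothing), lane `ym-19354-onsetsc-p2` (g4); sequel of
`BlockedActivityWLocChain` (parts 1–4: a mode decomposition of the centre response read on a set `T` adjacent to the end of a chain inhabits the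
LOCAL class `BlockedRepOnLoc` at the root functional).  Here the geometry that makes the tube `Y = tubeCells m = {0, e₁, …, (m+1) e₁}` the chain
case of Q-loc: by the range-one locality of the Wilson kernels (tree `FixedMesh.exists_near_cell_of_mem_plaquetteEdges`, Literature
`integral_ymSpecification_congr_of_eqOn`), the kernel of the tube reads the exterior datum only on cells adjacent to the tube — the SIDE cells
(first coordinate `≤ m+1`) and the `27` TIP cells `tipCells m` (first coordinate `m+2`) — so two data agreeing on the side cells and on the tip give
the same centre expectations (`integral_tubeCells_congr`); over an agreement class `WindowAgree w n (tubeCells m) τ` with the tube inside the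
window (`m + 1 ≤ 2n`) the side cells are window cells off `Y`, hence pinned, and **the centre response is a function of the datum on the tip alone**
(`integral_tubeCells_eq_of_windowAgree`).  Consequently the mode-decomposition hypothesis of `ChainData` for the tube asks for nothing but a summable
product-mode expansion of ONE response function of (centre cell, tip datum) — the spectral input named in `Q-LOC-ARCH-g4.md` §3 — and
`blockedRepOnLoc_tubeCells` records the tube case of the local class at the root functional in the W-currency of record (`WindowAgree`).

HONEST FRAMING: kernel-locality bookkeeping for the lane's own currency; the spectral input is NOT supplied here (open even at strong coupling);
nothing about weak coupling, a gap or Clay.  No `sorry`; axioms ⊆ {propext, Classical.choice, Quot.sound}; no instances, no notation.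
Refs: Georgii2011 (2.15) (range of the Wilson specification); SeilerLNP1982 Ch. 2; KoteckyPreiss1986.
-/

set_option autoImplicit false

noncomputable section

open MeasureTheory Finset
open Literature.MathematicalPhysics.QuantumFieldTheory Literature.MathematicalPhysics.QuantumLattice
open Summit.QuantumFields.YangMills.Cruxes.IR.Tempered (cellEdges windowCells regionEdges collarEdges)
open Summit.QuantumFields.YangMills.Cruxes.IR.CellTempered.Engine (frameCell frameCell_eq_iff mem_cellEdges_frameCell)

namespace Summit.QuantumFields.YangMills.Cruxes.IR.BlockedActivity

/-! ## §6 The tube and its readable exterior -/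

/-- The cells of the tube of length `m+1`: `0, e₁, …, (m+1) e₁`. -/
def tubeCells (m : ℕ) : Finset Cell := univ.image (tubeChain m)

/-- Membership in the tube. -/
theorem mem_tubeCells {m : ℕ} {c : Cell} : c ∈ tubeCells m ↔ ∃ k : Fin (m + 2), c = tubeCell k.val := by
  unfold tubeCells tubeChain
  simp only [mem_image, mem_univ, true_and]
  constructor
  · rintro ⟨k, hk⟩; exact ⟨k, hk.symm⟩
  · rintro ⟨k, hk⟩; exact ⟨k, hk.symm⟩

/-- The centre is a tube cell. -/
theorem zero_mem_tubeCells (m : ℕ) : (0 : Cell) ∈ tubeCells m :=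
  mem_tubeCells.2 ⟨0, by rw [Fin.val_zero, tubeCell_zero]⟩

/-- Tube cells have first coordinate `≤ m+1`. -/
theorem tubeCells_fst_le {m : ℕ} {c : Cell} (hc : c ∈ tubeCells m) : c 0 ≤ (m : ℤ) + 1 := by
  obtain ⟨k, rfl⟩ := mem_tubeCells.1 hc
  have := k.isLt
  simp only [tubeCell]
  omega

/-- Tube cells have vanishing transverse coordinates. -/
theorem tubeCells_apply_ne {m : ℕ} {c : Cell} (hc : c ∈ tubeCells m) {i : Fin 4} (hi : i ≠ 0) : c i = 0 := by
  obtain ⟨k, rfl⟩ := mem_tubeCells.1 hc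
  simp [tubeCell, hi]

section Readable

variable {G : Type} [Group G] [TopologicalSpace G] [IsTopologicalGroup G] [CompactSpace G]
  [MeasurableSpace G] [BorelSpace G] [SecondCountableTopology G] {N : ℕ} {ρ : G →* Matrix (Fin N) (Fin N) ℂ} {β : ℝ}
  {w : Fin 4 → ℤ → ℤ}

/-- **The tube reads the exterior datum on its side cells and its tip only.**  Two data agreeing on the edges of every cell outside the tube
that is adjacent to it with first coordinate `≤ m+1` (the SIDE cells) and on the edges of the tip cells give the same centre expectations under the
kernel of the tube (range-one locality of the Wilson kernels). -/
theorem integral_tubeCells_congr (hρ : Continuous ρ) (hw : ∀ i j, w i j + 1 ≤ w i (j + 1)) (m : ℕ) {σ σ' : LGConfig 4 G}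
    (hside : ∀ c : Cell, c ∉ tubeCells m → c 0 ≤ (m : ℤ) + 1 → (∃ y ∈ tubeCells m, CellAdj c y) → ∀ e ∈ cellEdges w c, σ e = σ' e)
    (htip : ∀ c ∈ tipCells m, ∀ e ∈ cellEdges w c, σ e = σ' e)
    {f : LGConfig 4 G → ℝ} (hf : IsCentreObs w f) :
    ∫ U, f U ∂(ymSpecification ρ β (regionEdges w (tubeCells m)) σ) =
      ∫ U, f U ∂(ymSpecification ρ β (regionEdges w (tubeCells m)) σ') := by
  classical
  refine integral_ymSpecification_congr_of_eqOn ρ hρ β (regionEdges w (tubeCells m)) hf.2.1 hf.1 fun e heΛ hor => ?_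
  rcases hor with hpl | hS
  · obtain ⟨p, hp, he⟩ := mem_biUnion.1 hpl
    obtain ⟨y, hy, hnear⟩ := FixedMesh.exists_near_cell_of_mem_plaquetteEdges hw hp he
    set c : Cell := frameCell w e with hc
    have hec : e ∈ cellEdges w c := mem_cellEdges_frameCell hw e
    have hcY : c ∉ tubeCells m := fun hcY => heΛ (mem_biUnion.2 ⟨c, hcY, hec⟩)
    have hadj : CellAdj c y := fun i => hnear i
    by_cases h0 : c 0 ≤ (m : ℤ) + 1
    · exact hside c hcY h0 ⟨y, hy, hadj⟩ e hec
    · -- the cell lies just beyond the reading cell: it is a tip cell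
      refine htip c ?_ e hec
      have hy0 : y 0 ≤ (m : ℤ) + 1 := tubeCells_fst_le hy
      have hc0 : c 0 = (m : ℤ) + 2 := by
        have h1 := abs_le.1 (hnear 0); omega
      have hy0' : y 0 = (m : ℤ) + 1 := by
        have h1 := abs_le.1 (hnear 0); omega
      have hyeq : y = tubeCell (m + 1) := by
        funext i
        by_cases hi : i = 0
        · subst hi; rw [hy0']; simp [tubeCell]
        · rw [tubeCells_apply_ne hy hi]; simp [tubeCell, hi]
      refine mem_filter.2 ⟨?_, hc0⟩
      unfold cellNbr
      rw [Fintype.mem_piFinset]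
      intro i
      have h1 := abs_le.1 (hnear i)
      rw [hyeq] at h1
      exact mem_Icc.2 ⟨by linarith [h1.1], by linarith [h1.2]⟩
  · exact absurd (mem_biUnion.2 ⟨0, zero_mem_tubeCells m, hS⟩) heΛ

/-- An edge of a cell outside `Y` is not an edge of the region `Y` (the frame cells partition the edges). -/
theorem not_mem_regionEdges_of_mem_cellEdges (hw : ∀ i j, w i j + 1 ≤ w i (j + 1)) {Y : Finset Cell} {c : Cell} (hc : c ∉ Y)
    {e : Literature.MathematicalPhysics.QuantumLattice.ZdEdge 4} (he : e ∈ cellEdges w c) : e ∉ regionEdges w Y := fun heY => by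
  obtain ⟨y, hy, hey⟩ := mem_biUnion.1 heY
  have h1 : frameCell w e = c := (frameCell_eq_iff hw e c).2 he
  have h2 : frameCell w e = y := (frameCell_eq_iff hw e y).2 hey
  exact hc (h1 ▸ h2 ▸ hy)

/-- **Over a window agreement class the tube's centre response is a function of the tip datum alone.**  If the tube lies inside the `n`-window
(`m + 1 ≤ 2n`), its side cells are window cells off the tube, hence pinned by `WindowAgree`; two data of the class agreeing on the tip give the same
centre expectations. -/
theorem integral_tubeCells_eq_of_windowAgree (hρ : Continuous ρ) (hw : ∀ i j, w i j + 1 ≤ w i (j + 1)) {m n : ℕ} (hmn : m + 1 ≤ 2 * n)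
    {τ σ σ' : LGConfig 4 G} (hσ : σ ∈ WindowAgree w n (tubeCells m) τ) (hσ' : σ' ∈ WindowAgree w n (tubeCells m) τ)
    (htip : ∀ c ∈ tipCells m, ∀ e ∈ cellEdges w c, σ e = σ' e) {f : LGConfig 4 G → ℝ} (hf : IsCentreObs w f) :
    ∫ U, f U ∂(ymSpecification ρ β (regionEdges w (tubeCells m)) σ) =
      ∫ U, f U ∂(ymSpecification ρ β (regionEdges w (tubeCells m)) σ') := by
  refine integral_tubeCells_congr hρ hw m (fun c hcY hc0 ⟨y, hy, hadj⟩ e he => ?_) htip hf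
  -- a side cell is a window cell: first coordinate in `[-1, m+1] ⊆ [-2n, 2n]`, the others in `[-1, 1]`
  have hcw : c ∈ windowCells n := by
    unfold windowCells
    rw [Fintype.mem_piFinset]
    intro i
    have h1 := abs_le.1 (hadj i)
    have hn : (1 : ℤ) ≤ 2 * (n : ℤ) := by omega
    by_cases hi : i = 0
    · subst hi
      have hy0 : y 0 ≤ (m : ℤ) + 1 := tubeCells_fst_le hy
      have hy0' : 0 ≤ y 0 := by
        obtain ⟨k, rfl⟩ := mem_tubeCells.1 hy; simp [tubeCell]
      exact mem_Icc.2 ⟨by omega, by omega⟩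
    · rw [tubeCells_apply_ne hy hi] at h1
      exact mem_Icc.2 ⟨by omega, by omega⟩
  have hecol : e ∈ collarEdges w n (tubeCells m) := by
    unfold collarEdges
    exact mem_sdiff.2 ⟨mem_biUnion.2 ⟨c, hcw, he⟩, not_mem_regionEdges_of_mem_cellEdges hw hcY he⟩
  rw [hσ e hecol, hσ' e hecol]

/-- **The tube case of Q-loc in the W-currency of record.**  A mode decomposition of the centre response of the tube `tubeCells m` over the agreement
class of `τ`, read on the tip (the only part of the datum the response can depend on, `integral_tubeCells_eq_of_windowAgree`), inhabits
`BlockedRepOnLoc ρ β w (tubeCells m) Z (WindowAgree w n (tubeCells m) τ)` at the root functional `Z = Σ_i t_i`, mode weights `t_i^{m+2}`. -/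
theorem blockedRepOnLoc_tubeCells (hρ : Continuous ρ) (m n : ℕ) (W : Chain.Weights)
    (φ : ℕ → LGConfig 4 G → ℝ) (hφm : ∀ i, Measurable (φ i)) (hφb : ∀ i U, |φ i U| ≤ 1)
    (ψ : ℕ → LGConfig 4 G → ℝ) (hψb : ∀ i σ, |ψ i σ| ≤ 1)
    (hψloc : ∀ i, ∀ σ σ' : LGConfig 4 G, (∀ q ∈ tipCells m, ∀ e ∈ cellEdges w q, σ e = σ' e) → ψ i σ = ψ i σ')
    (τ : LGConfig 4 G)
    (hrep : ∀ σ ∈ WindowAgree w n (tubeCells m) τ, ∀ f : LGConfig 4 G → ℝ, IsCentreObs w f →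
      ∫ U, f U ∂(ymSpecification ρ β (regionEdges w (tubeCells m)) σ) =
        ∫ U, f U ∂(ymSpecification ρ β (regionEdges w (tubeCells m)) τ) +
          ∑' i, W.t i ^ (m + 2) * ψ i σ * ∫ U, f U * φ i U ∂(ymSpecification ρ β (regionEdges w (tubeCells m)) τ)) :
    Nonempty (BlockedRepOnLoc ρ β w (tubeCells m) W.Z (WindowAgree w n (tubeCells m) τ)) :=
  blockedRepOnLoc_tube hρ (fun _ hp => tubeCells_fst_le hp) W φ hφm hφb ψ hψb hψloc τ hrep

end Readable

end Summit.QuantumFields.YangMills.Cruxes.IR.BlockedActivity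

end
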